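import Summits.BirchSwinnertonDyer.BirchSwinnertonDyer.Theorems.ResidualThetaTransportAtTwoThetaLayerLambdaCongruenceAtTwoCuspSpanKECalculus
import Mathlib.NumberTheory.LegendreSymbol.Basic
import HarnessLib

/-!
# Route `ResidualThetaTransportAtTwo`, cruxes Kan⁺ (stmt-BirchSwinnertonDyer-20688) / 21437: assembly of (G″)_p with the
# QUADRATIC character `ψ` (prime levels `p ≡ 1 (mod 8)` where `[(ℤ/p)ˣ : ⟨4, −1⟩]` is even)

Cell `bsd-wall`, lead prover `bsd-wall-rtt-p3` g9 (2026-08-28). THEOREMS ONLY; `--supports stmt-BirchSwinnertonDyer-20688`; BSD is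
not proved by this. At a prime level `p ≡ 1 (mod 8)` the trace form (G″)_p may hold with a NON-zero `ψ`: the quadratic character
(`d ↦ [d is a non-residue]`), which kills `±1`, `±4^k` and the elliptic residues (all squares when `8 ∣ p − 1`). The orbit
certificate (`…CuspSpanKECalculus`) then proves, for a fixed non-residue `r₀`, `K(r)` for every residue `r` and `E(r, r₀)` for
every non-residue `r`; `cuspSpanTrace_of_quadratic_certificate` turns this into (G″)_p: with `c := χ(β_{r₀})` and
`ψ(x) := c·[x^{(p−1)/2} = −1]` (Euler's criterion, multiplicative on units), `χ + ψ ∘ d` is additive, kills the small-trace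
elements (their `d` is a square: `d ∈ {±1, ±i}` or `d³ = ∓1`) and every `b = −1` element, hence vanishes by the descent
`chi_eq_zero_of_forall_b1`; so `χ = ψ ∘ d`.

References: [Rademacher1929] §1; [Knapp1993] Prop. 11.1; [Pollack2003] Conj. 6.3; Mathlib `ZMod.euler_criterion`.
-/

set_option autoImplicit false
set_option linter.dupNamespace false

open scoped MatrixGroups

open CongruenceSubgroup

namespace Summit.BirchSwinnertonDyer.BirchSwinnertonDyer.Theorems.SignedMuAtTwo

section AnyLevel

variable {N : ℕ} {χ : Gamma0 N → ZMod 2}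

/-- `E(r, r)` (reflexivity: `χ` depends only on `d mod N` on `B₁`). [folklore] -/
theorem E_refl (hadd : ∀ γ δ : Gamma0 N, χ (γ * δ) = χ γ + χ δ)
    (hsmall : ∀ γ : Gamma0 N, ((γ : SL(2, ℤ)) 0 0 + (γ : SL(2, ℤ)) 1 1).natAbs ≤ 2 → χ γ = 0) (r : ZMod N) :
    ∀ β β' : Gamma0 N, (β : SL(2, ℤ)) 0 1 = -1 → (β' : SL(2, ℤ)) 0 1 = -1 →
      ((((β : SL(2, ℤ)) 1 1 : ℤ) : ZMod N)) = r → ((((β' : SL(2, ℤ)) 1 1 : ℤ) : ZMod N)) = r → χ β = χ β' :=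
  fun _ _ hb hb' hd hd' ↦ chi_eq_of_apply_zero_one_eq_neg_one hadd hsmall hb hb' (by rw [hd, hd'])

/-- For `γ ∈ Γ₀(N)`: `d(γ)² = t·d(γ) − 1` in `ZMod N`, `t` the trace. [folklore] -/
theorem cast_apply_one_one_sq (γ : Gamma0 N) :
    ((((γ : SL(2, ℤ)) 1 1 : ℤ) : ZMod N)) * ((((γ : SL(2, ℤ)) 1 1 : ℤ) : ZMod N)) =
      (((((γ : SL(2, ℤ)) 0 0 + (γ : SL(2, ℤ)) 1 1 : ℤ)) : ZMod N)) * ((((γ : SL(2, ℤ)) 1 1 : ℤ) : ZMod N)) - 1 := by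
  have h := gamma0_apply_one_one_mul_apply_zero_zero γ
  push_cast
  linear_combination -h

end AnyLevel

section PrimeLevel

variable {p : ℕ} [Fact p.Prime] {χ : Gamma0 p → ZMod 2}

/-- At a prime `p ≡ 1 (mod 8)`: the lower-right entry of a small-trace element of `Γ₀(p)` is a square mod `p`
(`d = ±1`, `d² = −1`, or `d³ = ∓1`, and `−1`, `i` are squares). [cite: Knapp1993, Prop. 11.1] -/
theorem isSquare_cast_apply_one_one_of_small_trace (h8 : p % 8 = 1) (γ : Gamma0 p)
    (ht : ((γ : SL(2, ℤ)) 0 0 + (γ : SL(2, ℤ)) 1 1).natAbs ≤ 2) :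
    IsSquare ((((γ : SL(2, ℤ)) 1 1 : ℤ) : ZMod p)) := by
  have hp : p.Prime := Fact.out
  set d : ZMod p := ((((γ : SL(2, ℤ)) 1 1 : ℤ) : ZMod p)) with hd
  set t : ℤ := (γ : SL(2, ℤ)) 0 0 + (γ : SL(2, ℤ)) 1 1 with htdef
  have hsq : d * d = (t : ZMod p) * d - 1 := cast_apply_one_one_sq γ
  have hm1 : IsSquare (-1 : ZMod p) := ZMod.exists_sq_eq_neg_one_iff.mpr (by omega)
  obtain ⟨i, hi⟩ := hm1
  have hcases : t = -2 ∨ t = -1 ∨ t = 0 ∨ t = 1 ∨ t = 2 := by omega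
  rcases hcases with h | h | h | h | h <;> rw [h] at hsq <;> push_cast at hsq
  · -- `d = −1`
    have : (d + 1) * (d + 1) = 0 := by linear_combination hsq
    have hd1 : d = -1 := by
      rcases mul_eq_zero.mp this with h1 | h1 <;> linear_combination h1
    exact ⟨i, by rw [hd1, hi]⟩
  · -- `d² = −d − 1`, so `d³ = 1` and `d = (d²)²`
    refine ⟨d * d, ?_⟩
    have h3 : d * d * d = 1 := by linear_combination (d - 1) * hsq
    linear_combination (-d) * h3
  · -- `d² = −1`: `d^{(p−1)/2} = (−1)^{(p−1)/4} = 1`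
    have hd0 : d ≠ 0 := by
      intro h0; rw [h0] at hsq; simp at hsq
    rw [ZMod.euler_criterion p hd0]
    obtain ⟨m, hm⟩ : ∃ m, p / 2 = 4 * m := ⟨p / 8, by omega⟩
    rw [hm, pow_mul, show d ^ 4 = (d * d) * (d * d) by ring, show d * d = -1 by linear_combination hsq]
    norm_num
  · -- `d² = d − 1`, so `d³ = −1` and `d = −(d²)² = (i d²)²`
    refine ⟨i * (d * d), ?_⟩
    have h3 : d * d * d = -1 := by linear_combination (d + 1) * hsq
    linear_combination d * h3 + (d * d) * (d * d) * hi
  · -- `d = 1`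
    have : (d - 1) * (d - 1) = 0 := by linear_combination hsq
    have hd1 : d = 1 := by
      rcases mul_eq_zero.mp this with h1 | h1 <;> linear_combination h1
    exact ⟨1, by rw [hd1, mul_one]⟩

/-- **Assembly of (G″)_p with the quadratic `ψ`.** At a prime `p ≡ 1 (mod 8)`, for additive `χ` killing the small-trace
elements: if for a fixed residue `r₀` every non-zero residue `r` satisfies EITHER `r^{(p−1)/2} = 1` and `K(r)` OR
`r^{(p−1)/2} = −1` and `E(r, r₀)`, then `χ = ψ ∘ d` with `ψ` multiplicative on units (`ψ(x) = χ(β_{r₀})·[x^{(p−1)/2} ≠ 1]`).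
[cite: Pollack2003, Conj. 6.3] [cite: Rademacher1929, §1] -/
theorem cuspSpanTrace_of_quadratic_certificate (hp2 : p ≠ 2) (h8 : p % 8 = 1)
    (hadd : ∀ γ δ : Gamma0 p, χ (γ * δ) = χ γ + χ δ)
    (hsmall : ∀ γ : Gamma0 p, ((γ : SL(2, ℤ)) 0 0 + (γ : SL(2, ℤ)) 1 1).natAbs ≤ 2 → χ γ = 0)
    (r₀ : ZMod p) (hr₀ : r₀ ≠ 0)
    (hKE : ∀ r : ZMod p, r ≠ 0 →
      (r ^ (p / 2) = 1 ∧ ∀ β : Gamma0 p, (β : SL(2, ℤ)) 0 1 = -1 → ((((β : SL(2, ℤ)) 1 1 : ℤ) : ZMod p)) = r → χ β = 0) ∨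
      (r ^ (p / 2) = -1 ∧ ∀ β β' : Gamma0 p, (β : SL(2, ℤ)) 0 1 = -1 → (β' : SL(2, ℤ)) 0 1 = -1 →
        ((((β : SL(2, ℤ)) 1 1 : ℤ) : ZMod p)) = r → ((((β' : SL(2, ℤ)) 1 1 : ℤ) : ZMod p)) = r₀ → χ β = χ β')) :
    ∃ ψ : ZMod p → ZMod 2, (∀ x y : ZMod p, IsUnit x → IsUnit y → ψ (x * y) = ψ x + ψ y) ∧
      ∀ γ : Gamma0 p, χ γ = ψ ((((γ : SL(2, ℤ)) 1 1 : ℤ) : ZMod p)) := by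
  classical
  have hp : p.Prime := Fact.out
  have hm11 : (-1 : ZMod p) ≠ 1 := by
    intro h
    have h2 : (2 : ZMod p) = 0 := by linear_combination -h
    have h2' : ((2 : ℕ) : ZMod p) = 0 := by exact_mod_cast h2
    have := (ZMod.natCast_eq_zero_iff 2 p).mp h2'
    exact hp2 ((Nat.prime_dvd_prime_iff_eq hp Nat.prime_two).mp this)
  obtain ⟨β₀, hb₀, hd₀⟩ := exists_b_neg_one_of_isUnit (N := p) (isUnit_iff_ne_zero.mpr hr₀)
  set c : ZMod 2 := χ β₀ with hc
  let ψ : ZMod p → ZMod 2 := fun x ↦ if x ^ (p / 2) = 1 then 0 else c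
  have hψmul : ∀ x y : ZMod p, IsUnit x → IsUnit y → ψ (x * y) = ψ x + ψ y := by
    intro x y hx hy
    have hx0 := hx.ne_zero
    have hy0 := hy.ne_zero
    simp only [ψ, mul_pow]
    rcases ZMod.pow_div_two_eq_neg_one_or_one p hx0 with ex | ex <;>
      rcases ZMod.pow_div_two_eq_neg_one_or_one p hy0 with ey | ey <;> rw [ex, ey] <;> norm_num [hm11]
    exact (CharTwo.add_self_eq_zero c).symm
  -- `ψ` on the certificate residues
  have hψK : ∀ r : ZMod p, r ≠ 0 → r ^ (p / 2) = 1 → ψ r = 0 := fun r _ h ↦ by simp only [ψ, h, if_true]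
  have hψE : ∀ r : ZMod p, r ^ (p / 2) = -1 → ψ r = c := fun r h ↦ by simp only [ψ, h, hm11, if_false]
  -- the corrected character `χ' = χ + ψ ∘ d`
  let χ' : Gamma0 p → ZMod 2 := fun γ ↦ χ γ + ψ ((((γ : SL(2, ℤ)) 1 1 : ℤ) : ZMod p))
  have hadd' : ∀ γ δ : Gamma0 p, χ' (γ * δ) = χ' γ + χ' δ := by
    intro γ δ
    simp only [χ']
    rw [cast_mul_apply_one_one, hψmul _ _ (isUnit_gamma0_apply_one_one γ) (isUnit_gamma0_apply_one_one δ), hadd]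
    ring
  have hsmall' : ∀ γ : Gamma0 p, ((γ : SL(2, ℤ)) 0 0 + (γ : SL(2, ℤ)) 1 1).natAbs ≤ 2 → χ' γ = 0 := by
    intro γ ht
    simp only [χ']
    have hsq := isSquare_cast_apply_one_one_of_small_trace h8 γ ht
    have hne := (isUnit_gamma0_apply_one_one γ).ne_zero
    rw [hsmall γ ht, hψK _ hne ((ZMod.euler_criterion p hne).mp hsq), add_zero]
  have hB' : ∀ β : Gamma0 p, (β : SL(2, ℤ)) 0 1 = -1 → χ' β = 0 := by
    intro β hb
    simp only [χ']
    have hne := (isUnit_gamma0_apply_one_one β).ne_zero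
    rcases hKE _ hne with ⟨h1, hK⟩ | ⟨h1, hE⟩
    · rw [hK β hb rfl, hψK _ hne h1, add_zero]
    · rw [hE β β₀ hb hb₀ rfl hd₀, hψE _ h1, ← hc]
      exact CharTwo.add_self_eq_zero c
  have hsucc : ∀ δ : ℤ, IsUnit ((δ : ℤ) : ZMod p) ∨ IsUnit (((δ + 1 : ℤ)) : ZMod p) := by
    intro δ
    by_contra hcon
    push Not at hcon
    obtain ⟨h1, h2⟩ := hcon
    rw [isUnit_iff_ne_zero, not_not] at h1 h2
    push_cast at h2
    rw [h1, zero_add] at h2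
    exact one_ne_zero h2
  have hzero := chi_eq_zero_of_forall_b1 hsucc hadd' hsmall' (forall_b1_of_forall_b_neg_one hadd' hB')
  refine ⟨ψ, hψmul, fun γ ↦ ?_⟩
  have h := hzero γ
  simp only [χ'] at h
  have e : χ γ = -ψ ((((γ : SL(2, ℤ)) 1 1 : ℤ) : ZMod p)) := by linear_combination h
  rw [e, ZMod.neg_eq_self_mod_two]

end PrimeLevel

end Summit.BirchSwinnertonDyer.BirchSwinnertonDyer.Theorems.SignedMuAtTwo
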